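import Literature.AlgebraicGeometry.RelativeSpec.GeometricQuotientFreeEtale
import Literature.AlgebraicGeometry.RelativeSpec.GeometricQuotientRecognition
import Literature.AlgebraicGeometry.RelativeSpec.FreeQuotient
import Mathlib.AlgebraicGeometry.Morphisms.FlatMono
import HarnessLib

/-!
# A free finite quotient is a `G`-torsor: `X ×_Q X` is the disjoint union of the graphs of `G`
# (SGA 1, Exp. V, Prop. 2.6 (iii): «`X` est formellement principal homogène sous `G_Y`»)

Let the finite group `G` act on `X` over `Q` with `p : X → Q` an AFFINE geometric quotient
(`ActionOver.IsGeometricQuotient`, Mumford's (1), (2)). For `g ∈ G` the GRAPH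
`γ_g = (1, g) : X → X ×_Q X` (`pullback.lift (𝟙 X) (ρ.aut g).hom _`) is a section of the first
projection; when `p` is étale (e.g. the action is FREE: ★ `IsGeometricQuotient.etale_of_free`) it is an
OPEN AND CLOSED immersion (`isOpenImmersion_graph`, `isClosedImmersion_graph`: a section of the étale
separated `pr₁` is étale and a monomorphism, hence an open immersion by Mathlib
`IsOpenImmersion.of_flat_of_mono`, and a closed immersion by `IsClosedImmersion.of_comp`). For a FREE
action the graphs COVER `X ×_Q X` (`iUnion_range_graph_eq_univ_of_free`): a point of `X ×_Q X` is a pair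
of field-valued points of `X` over the same point of `Q`, and these differ by some `g`
(`exists_eq_comp_aut_of_comp_eq_of_free`, the intrinsic form of ★
`ActionOver.exists_eq_comp_aut_of_comp_toQuotient_eq`, transported along the isomorphism
`X/G ≅ Q` of ★ `isIso_quotientToBase_of_range_app`). This is SGA 1 V Prop. 2.6 (i) ⇒ (iii): the
morphism `X × G → X ×_Q X`, `(x, g) ↦ (x, xg)` is «surjectif puisque `G` est transitif sur les fibres,
injectif puisque `G` opère sans inertie, … un isomorphisme local … puisque `X` est étale sur `Y`».
Consequence, the TORSOR PROPERTY ON `T`-POINTS (`existsUnique_eq_comp_aut_of_comp_eq_of_connectedSpace`):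
two morphisms `t₁, t₂ : T → X` from a CONNECTED scheme with `t₁ ≫ p = t₂ ≫ p` differ by a (constant)
element of `G` — `(t₁, t₂) : T → X ×_Q X` lands in one clopen graph.

* `IsGeometricQuotient.isOpenImmersion_graph`, `isClosedImmersion_graph`, `isClopen_range_graph`;
* `IsGeometricQuotient.exists_eq_comp_aut_of_comp_eq_of_free` — fibres on field-valued points are
  `G`-orbits (intrinsic `p`);
* `IsGeometricQuotient.iUnion_range_graph_eq_univ_of_free` — the graphs cover `X ×_Q X`;
* `IsGeometricQuotient.eq_one_of_comp_aut_eq_of_free`, `eq_of_comp_aut_eq_of_free` — freeness /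
  simple transitivity on field-valued points; `disjoint_range_graph_of_free` — the graphs are disjoint;
* `IsGeometricQuotient.nonempty_isColimit_cofan_graph_of_free`, `isIso_sigmaDesc_graph_of_free` —
  **`X × G ≅ X ×_Q X`**: the cofan of graphs is a coproduct, `∐_G X ⥲ X ×_Q X`;
* `IsGeometricQuotient.existsUnique_eq_comp_aut_of_comp_eq_of_connectedSpace` — the torsor property on
  `T`-points for connected `T` (existence and uniqueness of `g`).

Everything is proved; no named facts, no definitions (the graph is the term
`pullback.lift (𝟙 X) (ρ.aut g).hom _`).

Mathlib searched (pin): `IsOpenImmersion.of_flat_of_mono`, `Etale.of_comp`,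
`Etale.iff_flat_and_formallyUnramified`, `IsClosedImmersion.of_comp`, `IsSplitMono.mk'`,
`IsOpenImmersion.lift`/`lift_fac`, `Scheme.fromSpecResidueField`, `pullback.hom_ext`,
`IsClopen.eq_univ`, `nonempty_isColimit_cofanMk_of`, `Opens.coe_disjoint` (all used); Mathlib has torsors for group OBJECTS
(`Mathlib.CategoryTheory`) but no quotients of schemes by finite groups.

## References

* A. Grothendieck, *SGA 1*, Exp. V, Prop. 2.6, Déf. 2.7 (revêtement principal de groupe `G`). [SGA1]
* D. Mumford, *Abelian Varieties* (1970), §7 Thm. p. 66 (1); §12. [MumfordAV1970]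
* C. Greither, LNM 1534 (1992), Ch. 0, Def. 1.5, Thm. 1.6 (i). [Greither1992CyclicGalois]
-/

noncomputable section

universe u

open CategoryTheory Limits AlgebraicGeometry TopologicalSpace Opposite

namespace Literature.AlgebraicGeometry.RelativeSpec.ActionOver.IsGeometricQuotient

variable {X Q : Scheme.{u}} {p : X ⟶ Q} {G : Type u} [Group G] {ρ : ActionOver p G}
  (hq : ρ.IsGeometricQuotient p)

set_option backward.isDefEq.respectTransparency false

include hq

/-! ### The graphs `γ_g = (1, g) : X → X ×_Q X` -/

/-- **The graph of `g` is an open immersion** `X → X ×_Q X` when the quotient map `p` is étale (e.g.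
for a free action, ★ `etale_of_free`): it is a section of the étale `pr₁`, hence étale
(`Etale.of_comp`) and a monomorphism, hence an open immersion (Mathlib
`IsOpenImmersion.of_flat_of_mono`). [cite: SGA1, Exp. V Prop. 2.6 ((i) ⇒ (iii))] -/
theorem isOpenImmersion_graph [Etale p] (g : G) :
    IsOpenImmersion (pullback.lift (𝟙 X) (ρ.aut g).hom (by rw [Category.id_comp, hq.comp_eq])) := by
  set γ := pullback.lift (𝟙 X) (ρ.aut g).hom (by rw [Category.id_comp, hq.comp_eq]) with hγ
  have hsec : γ ≫ pullback.fst p p = 𝟙 X := pullback.lift_fst _ _ _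
  haveI : Etale (γ ≫ pullback.fst p p) := by rw [hsec]; infer_instance
  haveI : Etale γ := Etale.of_comp γ (pullback.fst p p)
  haveI : IsSplitMono γ := IsSplitMono.mk' ⟨pullback.fst p p, hsec⟩
  haveI : Flat γ := (Etale.iff_flat_and_formallyUnramified.mp inferInstance).1
  haveI : LocallyOfFinitePresentation γ := (Etale.iff_flat_and_formallyUnramified.mp inferInstance).2.2
  exact IsOpenImmersion.of_flat_of_mono γ

/-- **The graph of `g` is a closed immersion** (a section of the separated `pr₁`; `p` affine is
separated). [cite: SGA1, Exp. V Prop. 2.6] -/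
theorem isClosedImmersion_graph [IsAffineHom p] (g : G) :
    IsClosedImmersion (pullback.lift (𝟙 X) (ρ.aut g).hom (by rw [Category.id_comp, hq.comp_eq])) := by
  set γ := pullback.lift (𝟙 X) (ρ.aut g).hom (by rw [Category.id_comp, hq.comp_eq]) with hγ
  have hsec : γ ≫ pullback.fst p p = 𝟙 X := pullback.lift_fst _ _ _
  haveI : IsClosedImmersion (γ ≫ pullback.fst p p) := by rw [hsec]; infer_instance
  exact IsClosedImmersion.of_comp γ (pullback.fst p p)

/-- The image of the graph of `g` is open and closed in `X ×_Q X` (`p` étale and affine).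
[cite: SGA1, Exp. V Prop. 2.6] -/
theorem isClopen_range_graph [Etale p] [IsAffineHom p] (g : G) :
    IsClopen (Set.range (pullback.lift (𝟙 X) (ρ.aut g).hom (by rw [Category.id_comp, hq.comp_eq]))) := by
  haveI := hq.isClosedImmersion_graph g
  haveI := hq.isOpenImmersion_graph g
  exact ⟨(pullback.lift (𝟙 X) (ρ.aut g).hom _).isClosedEmbedding.isClosed_range,
    (pullback.lift (𝟙 X) (ρ.aut g).hom _).isOpenEmbedding.isOpen_range⟩

/-! ### Free actions: the fibres on field-valued points are `G`-orbits, the graphs cover -/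

variable [Fintype G] [IsAffineHom p]
  (hfree : ∀ (V : Q.Opens), IsAffineOpen V → ∀ g : G, g ≠ 1 →
    Ideal.span (Set.range fun b : Γ(X, p ⁻¹ᵁ V) ↦ ρ.act g V b - b) = ⊤)
include hfree

/-- **The fibres of a free affine geometric quotient on field-valued points are `G`-orbits** (the
intrinsic form of ★ `ActionOver.exists_eq_comp_aut_of_comp_toQuotient_eq`): two `Ω`-valued points
of `X` with the same image in `Q` differ by an element of `G`. Transport along `X/G ≅ Q`
(★ `isIso_quotientToBase_of_range_app` on the affine cover of `Q`, Mumford's (2)).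
[cite: MumfordAV1970, §7 Thm. p. 66 (1)] [cite: Greither1992CyclicGalois, Ch. 0 Thm. 1.6 (i) (pp. 3–4)] -/
theorem exists_eq_comp_aut_of_comp_eq_of_free {Ω : Type u} [Field Ω] (x₁ x₂ : Spec (.of Ω) ⟶ X)
    (h : x₁ ≫ p = x₂ ≫ p) : ∃ g : G, x₂ = x₁ ≫ (ρ.aut g).hom := by
  haveI : IsIso ρ.quotientToBase :=
    ρ.isIso_quotientToBase_of_range_app (fun V : Q.affineOpens => V) (iSup_affineOpens_eq_top Q)
      (fun V => hq.app_injective V.1) (fun V => hq.range_app V.1)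
  refine ρ.exists_eq_comp_aut_of_comp_toQuotient_eq (fun V g hg => hfree V.1 V.2 g hg) x₁ x₂ ?_
  rw [← cancel_mono ρ.quotientToBase, Category.assoc, Category.assoc, ρ.toQuotient_quotientToBase, h]

omit hq [Fintype G] in
/-- **Freeness on field-valued points**: if `g ∈ G` fixes an `Ω`-valued point `x` of `X`
(`x ≫ g = x`), then `g = 1` — on an affine chart `p⁻¹V ≅ Spec B` through which `x` factors, the point
`φ : B → Ω` satisfies `φ ∘ g = φ`, hence kills the unit ideal generated by the `g·b − b` unless `g = 1`
(★ `GaloisAlgebras.smul_eq_self_of_algHom`; «injectif puisque `G` opère sans inertie»).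
[cite: SGA1, Exp. V Prop. 2.6 (i)] [cite: Greither1992CyclicGalois, Ch. 0 Thm. 1.6 (iv) (p. 3)] -/
theorem eq_one_of_comp_aut_eq_of_free {Ω : Type u} [Field Ω] (x : Spec (.of Ω) ⟶ X) {k : G}
    (hx : x ≫ (ρ.aut k).hom = x) : k = 1 := by
  -- an affine chart `V ∋ p(x)`; `x` factors through the affine open `p⁻¹V ≅ Spec B`
  let pt : ↥(Spec (.of Ω)) := IsLocalRing.closedPoint Ω
  obtain ⟨V, hV⟩ : ∃ V : Q.affineOpens, (x ≫ p) pt ∈ V.1 :=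
    TopologicalSpace.Opens.mem_iSup.mp ((iSup_affineOpens_eq_top Q).ge (Set.mem_univ _))
  have hA : IsAffineOpen (p ⁻¹ᵁ V.1) := V.2.preimage p
  have hxr : Set.range x ⊆ Set.range (p ⁻¹ᵁ V.1).ι := by
    rintro _ ⟨q, rfl⟩
    rw [Scheme.Opens.range_ι]
    obtain rfl : q = pt := Subsingleton.elim _ _
    exact hV
  obtain ⟨l, hl⟩ : ∃ l : Spec (.of Ω) ⟶ (p ⁻¹ᵁ V.1), l ≫ (p ⁻¹ᵁ V.1).ι = x :=
    ⟨_, IsOpenImmersion.lift_fac (p ⁻¹ᵁ V.1).ι x hxr⟩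
  obtain ⟨φ, hφ⟩ : ∃ φ : Γ(X, p ⁻¹ᵁ V.1) ⟶ .of Ω, Spec.map φ = l ≫ hA.isoSpec.hom :=
    ⟨_, Spec.map_preimage _⟩
  have hx' : x = Spec.map φ ≫ hA.isoSpec.inv ≫ (p ⁻¹ᵁ V.1).ι := by
    rw [hφ, Category.assoc, Iso.hom_inv_id_assoc, hl]
  -- `x ≫ k = x` reads `φ ∘ (k⁻¹ • ·) = φ` on the chart (`Spec (act k⁻¹) = k` there)
  have key : CommRingCat.ofHom (ρ.act k⁻¹ V.1) ≫ φ = φ := by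
    have h1 := ρ.specMap_act_comp_ι k⁻¹ V.1 hA
    rw [inv_inv] at h1
    apply Spec.map_injective
    rw [← cancel_mono (hA.isoSpec.inv ≫ (p ⁻¹ᵁ V.1).ι), Spec.map_comp, Category.assoc, h1]
    have h2 := hx
    rw [hx'] at h2
    simpa only [Category.assoc] using h2
  -- Chase–Harrison–Rosenberg freeness on points
  letI := ρ.mulSemiringAction V.1
  letI : Algebra Γ(X, p ⁻¹ᵁ V.1) Ω := φ.hom.toAlgebra
  have hk : k⁻¹ = 1 :=
    Literature.RingTheory.GaloisAlgebras.smul_eq_self_of_algHom Γ(X, p ⁻¹ᵁ V.1) G (hfree V.1 V.2)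
      (Algebra.ofId Γ(X, p ⁻¹ᵁ V.1) Ω) fun b => by
        have e := ConcreteCategory.congr_hom key b
        change φ.hom (ρ.act k⁻¹ V.1 b) = φ.hom b
        simpa [CommRingCat.comp_apply] using e
  exact inv_eq_one.mp hk

omit hq [Fintype G] in
/-- **Simple transitivity on field-valued points**: `x ≫ g = x ≫ h` forces `g = h`.
[cite: SGA1, Exp. V Prop. 2.6 (i)] -/
theorem eq_of_comp_aut_eq_of_free {Ω : Type u} [Field Ω] (x : Spec (.of Ω) ⟶ X) {g h : G}
    (e : x ≫ (ρ.aut g).hom = x ≫ (ρ.aut h).hom) : g = h := by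
  have e' : x ≫ (ρ.aut (h⁻¹ * g)).hom = x := by
    rw [map_mul, Aut.Aut_mul_def, Iso.trans_hom, ← Category.assoc, e, Category.assoc, map_inv,
      Aut.Aut_inv_def, Iso.symm_hom, Iso.hom_inv_id, Category.comp_id]
  exact (inv_mul_eq_one.mp (eq_one_of_comp_aut_eq_of_free hfree x e')).symm

omit [Fintype G] [IsAffineHom p] hfree in
/-- A field-valued point `t` of `X ×_Q X` lying on the graph of `k` has `pr₂ t = pr₁ t ≫ k` (lift `t`
through the open immersion `γ_k`). [cite: SGA1, Exp. V Prop. 2.6] -/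
private theorem comp_snd_eq_of_mem_range_graph [Etale p] {Ω : Type u} [Field Ω]
    (t : Spec (.of Ω) ⟶ pullback p p) (k : G)
    (hk : ∀ q, t q ∈ Set.range (pullback.lift (𝟙 X) (ρ.aut k).hom (by rw [Category.id_comp, hq.comp_eq]))) :
    t ≫ pullback.snd p p = (t ≫ pullback.fst p p) ≫ (ρ.aut k).hom := by
  haveI := hq.isOpenImmersion_graph k
  have hr : Set.range t ⊆
      Set.range (pullback.lift (𝟙 X) (ρ.aut k).hom (by rw [Category.id_comp, hq.comp_eq])) := by
    rintro _ ⟨q, rfl⟩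
    exact hk q
  have hs := IsOpenImmersion.lift_fac _ t hr
  have h1 : IsOpenImmersion.lift _ t hr = t ≫ pullback.fst p p := by
    have e := congrArg (· ≫ pullback.fst p p) hs
    simpa only [Category.assoc, pullback.lift_fst, Category.comp_id] using e
  have h2 := congrArg (· ≫ pullback.snd p p) hs
  simp only [Category.assoc, pullback.lift_snd, h1] at h2
  exact h2.symm

/-- **The graphs of `G` cover `X ×_Q X`** for a free action: a point `z` of `X ×_Q X` gives two
`κ(z)`-valued points of `X` over the same point of `Q`, which differ by some `g`, so `z` lies on the
graph of `g` («surjectif puisque `G` est transitif sur les fibres»).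
[cite: SGA1, Exp. V Prop. 2.6 ((i) ⇒ (iii))] -/
theorem iUnion_range_graph_eq_univ_of_free :
    ⋃ g : G, Set.range (pullback.lift (𝟙 X) (ρ.aut g).hom (by rw [Category.id_comp, hq.comp_eq])) =
      Set.univ := by
  rw [Set.eq_univ_iff_forall]
  intro z
  let t := (pullback p p).fromSpecResidueField z
  obtain ⟨g, hg⟩ := hq.exists_eq_comp_aut_of_comp_eq_of_free hfree (t ≫ pullback.fst p p)
    (t ≫ pullback.snd p p) (by rw [Category.assoc, Category.assoc, pullback.condition])
  refine Set.mem_iUnion.mpr ⟨g, ⟨(t ≫ pullback.fst p p) (IsLocalRing.closedPoint _), ?_⟩⟩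
  have ht : (t ≫ pullback.fst p p) ≫
      pullback.lift (𝟙 X) (ρ.aut g).hom (by rw [Category.id_comp, hq.comp_eq]) = t := by
    apply pullback.hom_ext
    · rw [Category.assoc, pullback.lift_fst, Category.comp_id]
    · rw [Category.assoc, pullback.lift_snd, hg]
  rw [← Scheme.Hom.comp_apply, ht]
  exact Scheme.fromSpecResidueField_apply z (IsLocalRing.closedPoint _)

/-- **The graphs are pairwise disjoint** for a free action («injectif puisque `G` opère sans
inertie»): a point on the graphs of `g` and `h` gives a field-valued point `x` with `x ≫ g = x ≫ h`.
So `X ×_Q X` is the DISJOINT union of the `|G|` clopen graphs `γ_g(X) ≅ X`: `X × G ≅ X ×_Q X`.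
[cite: SGA1, Exp. V Prop. 2.6 ((i) ⇒ (iii))] -/
theorem disjoint_range_graph_of_free {g h : G} (hgh : g ≠ h) :
    Disjoint (Set.range (pullback.lift (𝟙 X) (ρ.aut g).hom (by rw [Category.id_comp, hq.comp_eq])))
      (Set.range (pullback.lift (𝟙 X) (ρ.aut h).hom (by rw [Category.id_comp, hq.comp_eq]))) := by
  haveI : Etale p := hq.etale_of_free hfree
  rw [Set.disjoint_iff]
  rintro z ⟨hzg, hzh⟩
  apply hgh
  let t := (pullback p p).fromSpecResidueField z
  have ht : ∀ q, t q = z := fun q => by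
    obtain rfl : q = IsLocalRing.closedPoint _ := Subsingleton.elim _ _
    exact Scheme.fromSpecResidueField_apply z _
  exact eq_of_comp_aut_eq_of_free hfree (t ≫ pullback.fst p p)
    ((hq.comp_snd_eq_of_mem_range_graph t g fun q => Set.mem_of_eq_of_mem (ht q) hzg).symm.trans
      (hq.comp_snd_eq_of_mem_range_graph t h fun q => Set.mem_of_eq_of_mem (ht q) hzh))

/-- **`X × G ≅ X ×_Q X`** (SGA 1 V Prop. 2.6 (i) ⇒ (iii): «`X × G → X ×_Y X` … est un
isomorphisme»): for a free action the cofan of the graphs `γ_g : X → X ×_Q X`, `g ∈ G`, is a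
COPRODUCT — open immersions with disjoint images covering (Mathlib `nonempty_isColimit_cofanMk_of`).
[cite: SGA1, Exp. V Prop. 2.6 ((i) ⇒ (iii)), Déf. 2.7] -/
theorem nonempty_isColimit_cofan_graph_of_free :
    Nonempty (IsColimit (Cofan.mk (pullback p p) fun g : G =>
      pullback.lift (𝟙 X) (ρ.aut g).hom (by rw [Category.id_comp, hq.comp_eq]))) := by
  haveI : Etale p := hq.etale_of_free hfree
  haveI := fun g : G => hq.isOpenImmersion_graph g
  refine nonempty_isColimit_cofanMk_of _ ?_ fun g h hgh => ?_
  · rw [eq_top_iff]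
    rintro z -
    obtain ⟨g, hg⟩ := Set.mem_iUnion.mp
      (Set.eq_univ_iff_forall.mp (hq.iUnion_range_graph_eq_univ_of_free hfree) z)
    exact Opens.mem_iSup.mpr ⟨g, hg⟩
  · exact Opens.coe_disjoint.mp (by
      simpa only [Function.onFun, Scheme.Hom.coe_opensRange] using
        hq.disjoint_range_graph_of_free hfree hgh)

/-- The same as an isomorphism `∐_{g ∈ G} X ⥲ X ×_Q X` (Mathlib `Sigma.desc` of the graphs).
[cite: SGA1, Exp. V Prop. 2.6 ((i) ⇒ (iii))] -/
theorem isIso_sigmaDesc_graph_of_free :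
    IsIso (Sigma.desc fun g : G =>
      (pullback.lift (𝟙 X) (ρ.aut g).hom (by rw [Category.id_comp, hq.comp_eq]) : X ⟶ pullback p p)) := by
  exact (Cofan.nonempty_isColimit_iff_isIso_sigmaDesc (Cofan.mk (pullback p p) fun g : G =>
    (pullback.lift (𝟙 X) (ρ.aut g).hom (by rw [Category.id_comp, hq.comp_eq]) : X ⟶ pullback p p))).mp
    (hq.nonempty_isColimit_cofan_graph_of_free hfree)

/-- **The torsor property on `T`-points.** For a free affine geometric quotient `p : X → Q` and a
CONNECTED scheme `T`, two morphisms `t₁ t₂ : T → X` with `t₁ ≫ p = t₂ ≫ p` differ by an element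
of `G`: `(t₁, t₂) : T → X ×_Q X` meets the clopen graph of some `g` (the graphs cover), hence lands
in it (`T` connected), hence factors through the open immersion `γ_g`, i.e. `t₂ = t₁ ≫ g`. This is
the «formellement principal homogène» property of SGA 1 V Prop. 2.6 (iii) read on `T`-points.
[cite: SGA1, Exp. V Prop. 2.6, Déf. 2.7] [cite: MumfordAV1970, §7 Thm. p. 66] -/
theorem existsUnique_eq_comp_aut_of_comp_eq_of_connectedSpace {T : Scheme.{u}} [ConnectedSpace T]
    (t₁ t₂ : T ⟶ X) (h : t₁ ≫ p = t₂ ≫ p) : ∃! g : G, t₂ = t₁ ≫ (ρ.aut g).hom := by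
  haveI : Etale p := hq.etale_of_free hfree
  apply existsUnique_of_exists_of_unique
  swap
  · -- uniqueness: test on a field-valued point of `T`
    intro g g' hg hg'
    obtain ⟨τ₀⟩ := (inferInstance : Nonempty T)
    refine eq_of_comp_aut_eq_of_free hfree (T.fromSpecResidueField τ₀ ≫ t₁) ?_
    rw [Category.assoc, Category.assoc, ← hg, ← hg']
  -- the point `(t₁, t₂)(τ₀)` lies on some graph `γ_g`
  obtain ⟨τ₀⟩ := (inferInstance : Nonempty T)
  obtain ⟨g, hg⟩ := Set.mem_iUnion.mp
    (Set.eq_univ_iff_forall.mp (hq.iUnion_range_graph_eq_univ_of_free hfree) (pullback.lift t₁ t₂ h τ₀))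
  haveI := hq.isOpenImmersion_graph g
  -- `(t₁, t₂)⁻¹(graph g)` is clopen and non-empty, hence everything: `(t₁, t₂)` lands in the graph
  have hU := ((hq.isClopen_range_graph g).preimage (pullback.lift t₁ t₂ h).continuous).eq_univ ⟨τ₀, hg⟩
  have hrange : Set.range (pullback.lift t₁ t₂ h) ⊆
      Set.range (pullback.lift (𝟙 X) (ρ.aut g).hom (by rw [Category.id_comp, hq.comp_eq])) := by
    rintro _ ⟨τ, rfl⟩
    exact (Set.eq_univ_iff_forall.mp hU τ :)
  -- factor `(t₁, t₂)` through the open immersion `γ_g`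
  have hs := IsOpenImmersion.lift_fac _ _ hrange
  refine ⟨g, ?_⟩
  have h1 : IsOpenImmersion.lift _ _ hrange = t₁ := by
    have e := congrArg (· ≫ pullback.fst p p) hs
    simpa only [Category.assoc, pullback.lift_fst, Category.comp_id] using e
  have h2 := congrArg (· ≫ pullback.snd p p) hs
  simp only [Category.assoc, pullback.lift_snd, h1] at h2
  exact h2.symm

end Literature.AlgebraicGeometry.RelativeSpec.ActionOver.IsGeometricQuotient

end
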